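import Literature.AlgebraicGeometry.Milne1999.LefschetzCentraliser
import Literature.AlgebraicGeometry.Deligne1982.CMTypeRosatiPolarization
import Literature.NumberTheory.Automorphic.PicardCMEigenbasis
import Mathlib.LinearAlgebra.Lagrange
import Mathlib.LinearAlgebra.Eigenspace.Minpoly
import Mathlib.LinearAlgebra.Basis.Bilinear
import Mathlib.RingTheory.Trace.Basic
import HarnessLib

/-!
# `C(A)`, `S(A)`, `G(A)` of an abelian variety of CM type: the torus `{α | α · ια ∈ ℚ^×}` (Milne 1999b Prop. 2.5; 1999a §2)

Family `hodge`, layer `Literature/AlgebraicGeometry/Milne1999`; THEOREMS ONLY (no definition, no named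
fact, D-0026), sequel of `Milne1999/LefschetzCentraliser` (`centralizerAlgebra`, `centralizerGroup`,
`unitaryCentralizerGroup = S(A)(ℂ)`, `similitudeCentralizerGroup = G(A)(ℂ)` on `H¹(A(ℂ); ℂ)`). Written
for the cell `pub-hodgecm2` (COR-CM), LIT-FANOUT-PLAN §B-v3 R1 (c) "CM SPECIALISATION (the statement
INFRA-03-2 needs)", binder table `HOME/lit/milne.md` rows M8/M10.

## Sources read, verbatim

* J. S. Milne, *Lefschetz motives and the Tate conjecture*, Compositio Math. 117 (1999) 47–81
  [`paper:doi-10-1023-a-1000776613765`], §2, **Proposition 2.5** and its proof (held p0012 L8–L14):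
  "PROPOSITION 2.5. For any `Ψ`, `(L(A_Ψ), l(A_Ψ)) = (T^Ψ, t^Ψ)`. Proof. Choose a `ψ ∈ Ψ`. Let
  `(E_ψ, φ_ψ)` be as in the proof of Proposition 2.2, and let `A_Ψ` be the Abelian variety `A_{φ_ψ}`
  defined in the proof of Proposition 2.1. Then **`L(A_Ψ)` is the subtorus of `(𝔾_m)_{E_ψ/ℚ}` such that
  `L(A_Ψ)(ℚ) = {α ∈ E_ψ^× | α · ια ∈ ℚ^×}` and its canonical character `l(A_Ψ)` sends `α` to `α · ια`.**"
  (`A_Ψ` simple of CM-type with `End⁰(A_Ψ) = E_ψ`, `ι` complex conjugation); §1 p. 53 (p0009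
  L19–L31): "when equality holds [`[End⁰(A) : ℚ]_red = 2 dim A`] we say that `A` has many
  endomorphisms. Let `A` be a simple Abelian variety with many endomorphisms, and let `C₀(A)` be the
  centre of `End⁰(A)`. […] the canonical map `C₀(A) ⊗_ℚ Q → C(A)` is an isomorphism – this follows
  easily from the definition of `A`'s having many endomorphisms and the fact that `H₁(A)` is a free
  `C₀(A) ⊗_ℚ Q`-module (Milne, 1999a, 2.1). Therefore, `L(A) ≅ L₀(A)_{/Q}` where
  `L₀(A)(R) = {(γ, c) ∈ C₀(A)^× × R^× | γ†γ = c}`".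
* J. S. Milne, *Lefschetz classes on abelian varieties*, Duke Math. J. 96 (1999) 639–675
  [`paper:doi-10-1215-s0012-7094-99-09620-5`], §2 **Prop. 2.1** (p0009 L14–L16): "Let `A` be an
  abelian variety, and let `L` be a subfield of `End⁰(A)` containing the identity map. Then `V(A)` is a
  free `L ⊗_ℚ k`-module of rank `2 dim A/[L : ℚ]`."; p. 645 (p0007 L4–L9): "`C₀(A)` […] is a product
  of fields, each of which is either a CM-field or `ℚ`. Every Rosati involution `†` preserves each
  factor of `C₀(A)` and acts on it as complex conjugation. […] `S₀(A)(R) = {γ ∈ C₀(A) ⊗_ℚ R | γ†γ = 1}`."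

## What is proved (on the tree's carriers)

Data: a realisation `(A, ι, θ)` of a CM type `(K; Φ)` read on `H¹`
(`ComplexMultiplication.IsCMTypeRealisation Φ A ι θ`: `[K:ℚ] = 2 dim A`, `θ(a) = ι(a)^*` on `𝓞_K`,
one-dimensional `σ`-eigenlines `H¹_σ`, `σ : K → ℂ`), its eigenbasis `v_σ`
(`Deligne1982.exists_eigenbasis_of_isCMTypeRealisation`), and — for the form — a Rosati-compatible
polarization class `h` (`Q_h(ι(a)^*x, y) = Q_h(x, ι(ā)^*y)`, supplied by the tree theorem
`ComplexMultiplication.IsCMTypeRealisation.exists_rosati_kaehlerClass`, Shimura §6.2 Thm. 4 (3) /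
Milne CM Ex. 2.9) whose pairing is non-degenerate on `H¹` (hypothesis `hnd`, Hodge–Riemann in degree one).

* **`C(A) ⊆ C(E) = E ⊗ ℂ`** (`IsCMTypeRealisation.centralizerAlgebra_le_centralizer_range`): every
  element of `C(A) ⊗ ℂ` commutes with `θ(K)`; and `C(E)` is the DIAGONAL torus algebra of the
  eigenbasis (`exists_apply_eq_smul_of_mem_centralizer_range`: commuting with `θ(K)` ⟺ diagonal on
  `(v_σ)`; 1999a Prop. 2.1: `V(A)` is free of rank one over `E ⊗ k`). **`C(A) = C(E)`** as soon as
  `θ(K) ⊆ C(A)`, i.e. `E` is central in `End⁰(A)` — e.g. `A` simple, `End⁰(A) = E`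
  (`centralizer_range_le_centralizerAlgebra`, Lagrange interpolation: a diagonal operator is a polynomial
  in `θ(a₀)` for a separating `a₀`; `theta_mem_centralizerAlgebra` derives the hypothesis from
  `ι(a) ∘ φ = φ ∘ ι(a)`, `_of_comm` from a commutative `End(A)`) — Milne's "`C₀(A) ⊗ Q → C(A)` is an
  isomorphism" for a simple `A` with many endomorphisms, `C₀(A) = E`.
* **The form on the eigenbasis**: `Q_h(v_σ, v_τ) = 0` unless `τ = σ̄ := conj ∘ σ`
  (`polarizationPairingOne_basis_eq_zero_of_ne_conjugate`; from `σ(a) Q = τ(ā) Q`), and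
  `Q_h(v_σ, v_σ̄) ≠ 0` when `Q_h` is non-degenerate (`polarizationPairingOne_basis_conjugate_ne_zero`).
* **`S(A)(ℂ)` and `G(A)(ℂ)` inside the diagonal torus** (`mem_unitaryCentralizerGroup_of_eigenvalues`,
  `eigenvalue_mul_conjugate_eq_one_of_mem_unitaryCentralizerGroup`, and the `G`-versions): a diagonal
  `u = diag(d_σ) ∈ C(A)^×` preserves `Q_h` iff `d_σ d_σ̄ = 1` for all `σ`, and multiplies it by `c` iff
  `d_σ d_σ̄ = c` — the `ℂ`-points of `S₀ = {γ ∈ C₀ ⊗ R | γ · ιγ = 1}` (1999a p. 645) and of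
  `L₀(A)(R) = {(γ, c) | γ†γ = c}` with `†` = complex conjugation `d ↦ (d_σ̄)_σ` on `E ⊗ ℂ = ℂ^{Hom(E,ℂ)}`.
* **Prop. 2.5 on `ℚ`-points** (`IsCMTypeRealisation.mem_unitaryCentralizerGroup_iff_mul_conj_eq_one`,
  `IsCMTypeRealisation.mem_similitudeCentralizerGroup_iff_exists_rat`,
  `IsCMTypeRealisation.polarizationPairingOne_theta_theta`): for `α ∈ E = K` acting by `u = θ(α)`
  (with `θ(K) ⊆ C(A)`): **`θ(α) ∈ S(A)(ℂ) ⟺ α · ια = 1`**, **`θ(α) ∈ G(A)(ℂ) ⟺ α · ια ∈ ℚ^×`**, and then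
  the multiplier is `l(α) = α · ια`: `Q_h(θ(α)x, θ(α)y) = (α · ια) · Q_h(x, y)` — verbatim
  "`L(A_Ψ)(ℚ) = {α ∈ E_ψ^× | α · ια ∈ ℚ^×}` and its canonical character `l(A_Ψ)` sends `α` to `α · ια`"
  (an element of `K` all of whose complex embeddings agree is rational: trace argument,
  `trace_eq_sum_embeddings`).

NOT here: the torus `T^Ψ` as an algebraic group over `ℚ` and its character group
`X^*(T^Ψ) = {f : Ψ → ℤ}/{f = ιf, Σ f(ψ) = 0}` (LIT-FANOUT INFRA-03-1′/03-2, `CMTypeRank.lean`'s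
`translateSpan`); Prop. 2.1/2.3 (classification of simple CM abelian varieties by `(E, φ)`); Thm. 2.6.

## References

* [Milne1999] J. S. Milne, Lefschetz motives and the Tate conjecture, Compositio Math. 117 (1999)
  47–81: §1 p. 53 (many endomorphisms, `C₀(A) ⊗ Q ≅ C(A)`, `L₀(A)`), §2 Prop. 2.5 and proof (p. 56).
* [Milne1999LefschetzClasses] J. S. Milne, Lefschetz classes on abelian varieties, Duke Math. J. 96
  (1999) 639–675: §1 p. 645 (`C₀(A)`, `S₀(A)`, Prop. 1.7), §2 Prop. 2.1, the type IV computation (p. 650).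
* [Shimura1998] G. Shimura, Abelian Varieties with Complex Multiplication and Modular Functions (1998),
  §6.2 Thm. 4 (3) (Rosati involution = complex conjugation on `K`).
* [Deligne1982HodgeCycles] P. Deligne, Hodge cycles on abelian varieties, LNM 900 (1982), §4 p. 32
  (eigenbasis `H¹_{B,σ}`), Example 3.7.
-/

noncomputable section

open CategoryTheory NumberField
open Literature.AlgebraicTopology.SingularHomology
open Literature.AlgebraicGeometry.HodgeTheory
open Literature.AlgebraicGeometry.Motives
open Literature.AlgebraicGeometry.VanGeemen1994 (pullbackOne)
open Literature.AlgebraicGeometry.ComplexMultiplication (IsCMTypeRealisation)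
open Literature.NumberTheory.Automorphic
open NumberField.ComplexEmbedding (conjugate)

namespace Literature.AlgebraicGeometry.Milne1999

variable {K : Type} [Field K] [NumberField K] {Φ : CMType K} {A : AbelianVariety ℂ}
  {ι : 𝓞 K →+* End A} {θ : K →+* Module.End ℂ (complexBetti A.X 1)}

/-! ### `C(A) ⊆ C(E)`: elements of the centraliser are diagonal on the eigenbasis -/

section Diagonal

/-- **The engine**: an endomorphism `T` of `H¹(A(ℂ); ℂ)` commuting with `θ(a) = ι(a)^*` for all
`a ∈ 𝓞_K` maps every non-zero vector of the `σ`-eigenline `H¹_σ` to a multiple of itself (`T H¹_σ ⊆ H¹_σ`,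
the eigenline being cut out by the integers, and `dim H¹_σ = 1`). [cite: Milne1999LefschetzClasses, §2 Prop. 2.1 (V(A) free over L ⊗ k)]
[cite: Deligne1982HodgeCycles, §4 p. 32] -/
theorem _root_.Literature.AlgebraicGeometry.ComplexMultiplication.IsCMTypeRealisation.exists_apply_eq_smul_of_commute_integers
    (hA : IsCMTypeRealisation Φ A ι θ) {T : Module.End ℂ (complexBetti A.X 1)}
    (hT : ∀ a : 𝓞 K, θ (a : K) * T = T * θ (a : K)) {σ : K →+* ℂ} {w : complexBetti A.X 1}
    (hw : w ∈ PicardCM.eigenline θ σ) (hw0 : w ≠ 0) : ∃ t : ℂ, T w = t • w := by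
  have hmem : T w ∈ PicardCM.eigenline θ σ := by
    refine PicardCM.mem_eigenline_of_forall_integer θ σ fun a ↦ ?_
    have e := LinearMap.congr_fun (hT a) w
    rw [Module.End.mul_apply, Module.End.mul_apply, (PicardCM.mem_eigenline_iff θ σ).1 hw, map_smul] at e
    exact e
  have h1 : Module.finrank ℂ (PicardCM.eigenline θ σ) = 1 := (hA.2.2.2 σ).1
  have hw0' : (⟨w, hw⟩ : PicardCM.eigenline θ σ) ≠ 0 := fun h ↦ hw0 (congrArg Subtype.val h)
  obtain ⟨t, ht⟩ := (finrank_eq_one_iff_of_nonzero' _ hw0').1 h1 ⟨T w, hmem⟩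
  exact ⟨t, (congrArg Subtype.val ht).symm⟩

/-- **`C(A) ⊗ ℂ ⊆ C(E)`**: every element of Milne's centraliser `C(A)` commutes with the whole field
`E = K` acting on `H¹` (it is diagonal on the eigenbasis `(v_σ)`, as is `θ(a)`; `θ(a) = ι(a)^*` on
`𝓞_K ⊆ End(A)`). [cite: Milne1999, §1 p. 53 (`C₀(A) ⊗ Q → C(A)`)] [cite: Milne1999LefschetzClasses, §2 Prop. 2.1] -/
theorem _root_.Literature.AlgebraicGeometry.ComplexMultiplication.IsCMTypeRealisation.centralizerAlgebra_le_centralizer_range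
    (hA : IsCMTypeRealisation Φ A ι θ) :
    centralizerAlgebra A ≤ Subalgebra.centralizer ℂ (Set.range θ) := by
  classical
  obtain ⟨v, hv, -⟩ := Deligne1982.exists_eigenbasis_of_isCMTypeRealisation hA
  intro T hT
  have hT' : ∀ a : 𝓞 K, θ (a : K) * T = T * θ (a : K) := fun a ↦ by
    rw [← hA.2.2.1 a]
    exact (mem_centralizerAlgebra_iff.1 hT) (ι a)
  rw [Subalgebra.mem_centralizer_iff]
  rintro _ ⟨a, rfl⟩
  refine v.ext fun σ ↦ ?_
  obtain ⟨t, ht⟩ := hA.exists_apply_eq_smul_of_commute_integers hT'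
    ((PicardCM.mem_eigenline_iff θ σ).2 (hv σ)) (v.ne_zero σ)
  change θ a (T (v σ)) = T (θ a (v σ))
  rw [ht, map_smul, hv, map_smul, ht, smul_comm]

/-- **`C(E)` is the diagonal torus algebra**: an endomorphism commuting with `θ(K)` is diagonal on the
eigenbasis (`H¹ = ⊕_σ H¹_σ`, lines with pairwise distinct characters — "`V(A)` is a free
`L ⊗_ℚ k`-module of rank `2 dim A/[L : ℚ]`" `= 1` for `L = E`). [cite: Milne1999LefschetzClasses, §2 Prop. 2.1]
[cite: Deligne1982HodgeCycles, §4 p. 32] -/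
theorem exists_apply_eq_smul_of_mem_centralizer_range (hA : IsCMTypeRealisation Φ A ι θ)
    {v : Module.Basis (K →+* ℂ) ℂ (complexBetti A.X 1)} (hv : ∀ (σ : K →+* ℂ) (a : K), θ a (v σ) = σ a • v σ)
    {T : Module.End ℂ (complexBetti A.X 1)} (hT : T ∈ Subalgebra.centralizer ℂ (Set.range θ))
    (σ : K →+* ℂ) : ∃ t : ℂ, T (v σ) = t • v σ :=
  hA.exists_apply_eq_smul_of_commute_integers
    (fun a ↦ (Subalgebra.mem_centralizer_iff ℂ).1 hT _ ⟨(a : K), rfl⟩)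
    ((PicardCM.mem_eigenline_iff θ σ).2 (hv σ)) (v.ne_zero σ)

/-- Every automorphism in `(C(A) ⊗ ℂ)^×` is diagonal on the eigenbasis: `u v_σ = d_σ v_σ`.
[cite: Milne1999, §1 p. 53] [cite: Milne1999LefschetzClasses, §2 Prop. 2.1] -/
theorem _root_.Literature.AlgebraicGeometry.ComplexMultiplication.IsCMTypeRealisation.exists_eigenvalues_of_mem_centralizerGroup
    (hA : IsCMTypeRealisation Φ A ι θ) {v : Module.Basis (K →+* ℂ) ℂ (complexBetti A.X 1)}
    (hv : ∀ (σ : K →+* ℂ) (a : K), θ a (v σ) = σ a • v σ)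
    {u : complexBetti A.X 1 ≃ₗ[ℂ] complexBetti A.X 1} (hu : u ∈ centralizerGroup A) :
    ∃ d : (K →+* ℂ) → ℂ, ∀ σ, u (v σ) = d σ • v σ := by
  have hmem := hA.centralizerAlgebra_le_centralizer_range (mem_centralizerGroup_iff_coe_mem.1 hu)
  choose d hd using fun σ ↦ exists_apply_eq_smul_of_mem_centralizer_range hA hv hmem σ
  exact ⟨d, fun σ ↦ hd σ⟩

/-- A separating element: some `a₀ ∈ K` on which the complex embeddings of `K` are pairwise distinct
(a primitive element of `K/ℚ`). [folklore] -/
private theorem exists_embedding_apply_injective (K : Type) [Field K] [NumberField K] :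
    ∃ a₀ : K, Function.Injective fun σ : K →+* ℂ ↦ σ a₀ := by
  obtain ⟨α, hα⟩ := Field.exists_primitive_element ℚ K
  have hinjα : Function.Injective fun φ : K →ₐ[ℚ] ℂ ↦ φ α :=
    (Field.primitive_element_iff_algHom_eq_of_eval' ℚ ℂ (fun x ↦ IsAlgClosed.splits _) α).1 hα
  refine ⟨α, fun σ σ' hσ ↦ ?_⟩
  have h := hinjα (show (fun φ : K →ₐ[ℚ] ℂ ↦ φ α) σ.toRatAlgHom = (fun φ : K →ₐ[ℚ] ℂ ↦ φ α) σ'.toRatAlgHom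
    from hσ)
  rw [← RingHom.toRatAlgHom_toRingHom σ, ← RingHom.toRatAlgHom_toRingHom σ', h]

/-- **`C(E) ⊆ C(A)` when `E` is central in `End⁰(A)`** (`θ(K) ⊆ C(A)`; e.g. `A` simple with
`End⁰(A) = E`): an endomorphism commuting with `θ(K)` is diagonal on the eigenbasis, hence a polynomial
(Lagrange interpolation at the distinct nodes `σ(a₀)`) in `θ(a₀)` for a separating `a₀ ∈ K`, hence lies in
the subalgebra `C(A) ∋ θ(a₀)`. With the previous theorem: `C(A) = C(E)` — "the canonical map
`C₀(A) ⊗_ℚ Q → C(A)` is an isomorphism" for a simple `A` with many endomorphisms. [cite: Milne1999, §1 p. 53]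
[cite: Milne1999LefschetzClasses, §2 Prop. 2.1 and Remark 2.3] -/
theorem _root_.Literature.AlgebraicGeometry.ComplexMultiplication.IsCMTypeRealisation.centralizer_range_le_centralizerAlgebra
    (hA : IsCMTypeRealisation Φ A ι θ) (hθ : ∀ a : K, θ a ∈ centralizerAlgebra A) :
    Subalgebra.centralizer ℂ (Set.range θ) ≤ centralizerAlgebra A := by
  classical
  obtain ⟨a₀, ha₀⟩ := exists_embedding_apply_injective K
  obtain ⟨v, hv, -⟩ := Deligne1982.exists_eigenbasis_of_isCMTypeRealisation hA
  intro T hT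
  choose t ht using fun σ ↦ exists_apply_eq_smul_of_mem_centralizer_range hA hv hT σ
  set p : Polynomial ℂ := Lagrange.interpolate Finset.univ (fun σ : K →+* ℂ ↦ σ a₀) t with hp
  have hpev : ∀ σ : K →+* ℂ, p.eval (σ a₀) = t σ := fun σ ↦ by
    rw [hp]
    exact Lagrange.eval_interpolate_at_node t (ha₀.injOn) (Finset.mem_univ σ)
  have hTp : T = Polynomial.aeval (θ a₀) p := by
    refine v.ext fun σ ↦ ?_
    rw [ht, Module.End.aeval_apply_of_hasEigenvector ⟨Module.End.mem_eigenspace_iff.2 (hv σ a₀), v.ne_zero σ⟩,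
      hpev]
  rw [hTp]
  exact Algebra.adjoin_le (Set.singleton_subset_iff.2 (hθ a₀)) (Polynomial.aeval_mem_adjoin_singleton ℂ _)

/-- **`C(A) = C(E)`** (`= E ⊗ ℂ`, the diagonal torus algebra) for a CM realisation with `θ(K) ⊆ C(A)`.
[cite: Milne1999, §1 p. 53 (`C₀(A) ⊗ Q ≅ C(A)`)] [cite: Milne1999LefschetzClasses, §2 Prop. 2.1] -/
theorem _root_.Literature.AlgebraicGeometry.ComplexMultiplication.IsCMTypeRealisation.centralizerAlgebra_eq_centralizer_range
    (hA : IsCMTypeRealisation Φ A ι θ) (hθ : ∀ a : K, θ a ∈ centralizerAlgebra A) :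
    centralizerAlgebra A = Subalgebra.centralizer ℂ (Set.range θ) :=
  le_antisymm hA.centralizerAlgebra_le_centralizer_range (hA.centralizer_range_le_centralizerAlgebra hθ)

/-- The inverse of a unit of `C(A) ⊗ ℂ` lies in `C(A) ⊗ ℂ` (private plumbing). [folklore] -/
private theorem mem_centralizerAlgebra_of_mul_eq_one {T S : Module.End ℂ (complexBetti A.X 1)}
    (hT : T ∈ centralizerAlgebra A) (h1 : T * S = 1) (h2 : S * T = 1) : S ∈ centralizerAlgebra A := by
  rw [mem_centralizerAlgebra_iff] at hT ⊢
  intro φ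
  calc pullbackOne A φ * S = (S * T) * (pullbackOne A φ * S) := by rw [h2, one_mul]
    _ = S * (T * pullbackOne A φ) * S := by simp only [mul_assoc]
    _ = S * (pullbackOne A φ * T) * S := by rw [hT φ]
    _ = S * pullbackOne A φ * (T * S) := by simp only [mul_assoc]
    _ = S * pullbackOne A φ := by rw [h1, mul_one]

/-- `(f ≫ g)^* = f^* ∘ g^*` on `H¹`, in `Module.End` (contravariance of cohomology). [folklore] -/
private theorem pullbackOne_comp (φ ψ : A ⟶ A) : pullbackOne A (φ ≫ ψ) = pullbackOne A φ * pullbackOne A ψ := by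
  change (complexBetti.map (φ.hom.hom.hom ≫ ψ.hom.hom.hom) 1).hom = _
  rw [complexBetti.map_comp, ModuleCat.hom_comp]
  rfl

/-- **`θ(K) ⊆ C(A)` when `ι(𝓞_K)` is central in `End(A)`** (`ι(a) ∘ φ = φ ∘ ι(a)` for all `φ`; e.g.
`End⁰(A) = E` for a simple CM abelian variety): every `θ(a)`, `a ∈ K`, commutes with every `φ^*`
(`a = x/y` with `x, y ∈ 𝓞_K`; units of a centraliser have their inverses in it). [cite: Milne1999, §1 p. 53 and §2 p. 54]
[cite: Milne1999LefschetzClasses, §2 (type IV, E = End⁰(A) with centre K)] -/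
theorem _root_.Literature.AlgebraicGeometry.ComplexMultiplication.IsCMTypeRealisation.theta_mem_centralizerAlgebra
    (hA : IsCMTypeRealisation Φ A ι θ) (hcomm : ∀ (φ : A ⟶ A) (a : 𝓞 K), ι a ≫ φ = φ ≫ ι a) (a : K) :
    θ a ∈ centralizerAlgebra A := by
  have hint : ∀ b : 𝓞 K, θ (b : K) ∈ centralizerAlgebra A := fun b ↦ by
    rw [← hA.2.2.1 b, mem_centralizerAlgebra_iff]
    intro φ
    change pullbackOne A φ * pullbackOne A (ι b) = pullbackOne A (ι b) * pullbackOne A φ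
    rw [← pullbackOne_comp, ← pullbackOne_comp, hcomm]
  obtain ⟨x, y, hy, rfl⟩ := IsFractionRing.div_surjective (A := 𝓞 K) a
  have hy0 : algebraMap (𝓞 K) K y ≠ 0 := RingOfIntegers.coe_ne_zero_iff.mpr (nonZeroDivisors.ne_zero hy)
  rw [div_eq_mul_inv, map_mul]
  refine Subalgebra.mul_mem _ (hint x) (mem_centralizerAlgebra_of_mul_eq_one (hint y) ?_ ?_)
  · rw [← map_mul, mul_inv_cancel₀ hy0, map_one]
  · rw [← map_mul, inv_mul_cancel₀ hy0, map_one]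

/-- `θ(K) ⊆ C(A)` when `End(A)` is commutative (a simple CM abelian variety: `End⁰(A) = E` is a field).
[cite: Milne1999, §2 p. 54 ("of CM-type if `End⁰(A)` is a field (necessarily CM) of degree `2 dim A`")] -/
theorem _root_.Literature.AlgebraicGeometry.ComplexMultiplication.IsCMTypeRealisation.theta_mem_centralizerAlgebra_of_comm
    (hA : IsCMTypeRealisation Φ A ι θ) (hEnd : ∀ φ ψ : A ⟶ A, φ ≫ ψ = ψ ≫ φ) (a : K) :
    θ a ∈ centralizerAlgebra A :=
  hA.theta_mem_centralizerAlgebra (fun φ b ↦ hEnd (ι b) φ) a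

end Diagonal

/-! ### The form on the eigenbasis and the torus `{d | d_σ d_σ̄ = c}` -/

section Torus

variable [IsCMField K] {h : complexBetti A.X 2} {v : Module.Basis (K →+* ℂ) ℂ (complexBetti A.X 1)}

/-- **The Rosati-compatible form pairs `H¹_σ` only with `H¹_σ̄`**: if `Q_h(ι(a)^*x, y) = Q_h(x, ι(ā)^*y)`
(Rosati involution = complex conjugation on `K`) then `Q_h(v_σ, v_τ) = 0` unless `τ = σ̄ = conj ∘ σ`
(`σ(a) Q_h(v_σ, v_τ) = τ(ā) Q_h(v_σ, v_τ)` for all `a ∈ 𝓞_K`, and complex embeddings agreeing on `𝓞_K`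
agree). Milne 1999a §2, type IV: "`φ̄((x₁, x₂), (y₁, y₂)) = (φ₀(x₁, y₂), -φ₀(y₁, x₂))`".
[cite: Milne1999LefschetzClasses, §2 pp. 650–651 (type IV) and Remark 2.2] [cite: Shimura1998, §6.2 Theorem 4 (3)] -/
theorem polarizationPairingOne_basis_eq_zero_of_ne_conjugate
    (hv' : ∀ (σ : K →+* ℂ) (a : 𝓞 K), complexBetti.map (ι a).hom.hom.hom 1 (v σ) = σ (a : K) • v σ)
    {j : ℕ}
    (hros : ∀ (a ac : 𝓞 K), (ac : K) = IsCMField.complexConj K (a : K) → ∀ x y : complexBetti A.X 1,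
      polarizationPairingOne A.X h j (complexBetti.map (ι a).hom.hom.hom 1 x) y =
        polarizationPairingOne A.X h j x (complexBetti.map (ι ac).hom.hom.hom 1 y))
    {σ τ : K →+* ℂ} (hστ : τ ≠ conjugate σ) :
    polarizationPairingOne A.X h j (v σ) (v τ) = 0 := by
  by_contra hne
  apply hστ
  have key : ∀ a : 𝓞 K,
      (σ (a : K) - conjugate τ (a : K)) • polarizationPairingOne A.X h j (v σ) (v τ) = 0 := by
    intro a
    have e := hros a (IsCMField.ringOfIntegersComplexConj K a)
      (IsCMField.coe_ringOfIntegersComplexConj K a) (v σ) (v τ)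
    rw [hv', hv', map_smul, LinearMap.smul_apply, map_smul, IsCMField.coe_ringOfIntegersComplexConj,
      IsCMField.complexEmbedding_complexConj] at e
    rw [sub_smul, sub_eq_zero, e, NumberField.ComplexEmbedding.conjugate_coe_eq]
  have hστ' : ∀ a : 𝓞 K, σ (a : K) = conjugate τ (a : K) := fun a ↦ by
    rcases smul_eq_zero.1 (key a) with h0 | h0
    · exact sub_eq_zero.1 h0
    · exact absurd h0 hne
  have hext : σ = conjugate τ :=
    IsLocalization.ringHom_ext (nonZeroDivisors (𝓞 K)) (RingHom.ext fun a ↦ hστ' a)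
  rw [hext]
  exact (NumberField.ComplexEmbedding.involutive_conjugate K τ).symm

/-- **`Q_h(v_σ, v_σ̄) ≠ 0`** for a non-degenerate Rosati-compatible pairing (else `Q_h(v_σ, ·) = 0`).
("`φ₀` non-degenerate", type IV; Hodge–Riemann in degree one supplies `hnd`.)
[cite: Milne1999LefschetzClasses, §2 pp. 650–651 (type IV) and Remark 2.2] -/
theorem polarizationPairingOne_basis_conjugate_ne_zero
    (hv' : ∀ (σ : K →+* ℂ) (a : 𝓞 K), complexBetti.map (ι a).hom.hom.hom 1 (v σ) = σ (a : K) • v σ)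
    {j : ℕ}
    (hros : ∀ (a ac : 𝓞 K), (ac : K) = IsCMField.complexConj K (a : K) → ∀ x y : complexBetti A.X 1,
      polarizationPairingOne A.X h j (complexBetti.map (ι a).hom.hom.hom 1 x) y =
        polarizationPairingOne A.X h j x (complexBetti.map (ι ac).hom.hom.hom 1 y))
    (hnd : ∀ x : complexBetti A.X 1, (∀ y, polarizationPairingOne A.X h j x y = 0) → x = 0)
    (σ : K →+* ℂ) : polarizationPairingOne A.X h j (v σ) (v (conjugate σ)) ≠ 0 := by
  intro h0
  have hall : ∀ τ, polarizationPairingOne A.X h j (v σ) (v τ) = 0 := fun τ ↦ by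
    by_cases hτ : τ = conjugate σ
    · rw [hτ]; exact h0
    · exact polarizationPairingOne_basis_eq_zero_of_ne_conjugate hv' hros hτ
  have hz : polarizationPairingOne A.X h j (v σ) = 0 :=
    v.ext fun τ ↦ by rw [LinearMap.zero_apply]; exact hall τ
  exact v.ne_zero σ (hnd _ fun y ↦ by rw [hz, LinearMap.zero_apply])

/-- **The torus character**: for `u` diagonal on the eigenbasis, `u v_σ = d_σ v_σ`, with
`d_σ d_σ̄ = c` for all `σ`, one has `Q_h(u x, u y) = c · Q_h(x, y)` — the multiplier `γ†γ = c` of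
`L₀(A)(R) = {(γ, c) ∈ C₀(A)^× × R^× | γ†γ = c}`, `†` acting on `E ⊗ ℂ = ℂ^{Hom(E,ℂ)}` by `d ↦ (d_σ̄)_σ`.
[cite: Milne1999, §1 p. 53 (L₀(A)) and §2 Prop. 2.5 (proof)] [cite: Milne1999LefschetzClasses, §1 p. 645 (S₀(A))] -/
theorem polarizationPairingOne_map_map_of_eigenvalues
    (hv' : ∀ (σ : K →+* ℂ) (a : 𝓞 K), complexBetti.map (ι a).hom.hom.hom 1 (v σ) = σ (a : K) • v σ)
    (hros : ∀ (a ac : 𝓞 K), (ac : K) = IsCMField.complexConj K (a : K) → ∀ x y : complexBetti A.X 1,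
      polarizationPairingOne A.X h (A.dim - 1) (complexBetti.map (ι a).hom.hom.hom 1 x) y =
        polarizationPairingOne A.X h (A.dim - 1) x (complexBetti.map (ι ac).hom.hom.hom 1 y))
    {u : complexBetti A.X 1 ≃ₗ[ℂ] complexBetti A.X 1} {d : (K →+* ℂ) → ℂ} (hd : ∀ σ, u (v σ) = d σ • v σ)
    {c : ℂ} (hc : ∀ σ, d σ * d (conjugate σ) = c) (x y : complexBetti A.X 1) :
    polarizationPairingOne A.X h (A.dim - 1) (u x) (u y) = c • polarizationPairingOne A.X h (A.dim - 1) x y := by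
  have H : (polarizationPairingOne A.X h (A.dim - 1)).compl₁₂ (u : complexBetti A.X 1 →ₗ[ℂ] complexBetti A.X 1)
      (u : complexBetti A.X 1 →ₗ[ℂ] complexBetti A.X 1) = c • polarizationPairingOne A.X h (A.dim - 1) := by
    refine LinearMap.ext_basis v v fun σ τ ↦ ?_
    simp only [LinearMap.compl₁₂_apply, LinearEquiv.coe_coe, hd, map_smul, LinearMap.smul_apply, smul_smul]
    by_cases hτ : τ = conjugate σ
    · rw [hτ, mul_comm (d (conjugate σ)) (d σ), hc]
    · rw [polarizationPairingOne_basis_eq_zero_of_ne_conjugate hv' hros hτ, smul_zero, smul_zero]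
  have e := LinearMap.congr_fun₂ H x y
  rw [LinearMap.compl₁₂_apply, LinearEquiv.coe_coe, LinearMap.smul_apply, LinearMap.smul_apply] at e
  exact e

/-- **`S₀(ℂ)`: a diagonal `u ∈ C(A)^×` with `d_σ d_σ̄ = 1` for all `σ` lies in `S(A)(ℂ)`** ("`γ†γ = 1`",
`†` = complex conjugation on `C₀(A)`). [cite: Milne1999LefschetzClasses, §1 p. 645 (S₀(A))] [cite: Milne1999, §2 Prop. 2.5 (proof)] -/
theorem mem_unitaryCentralizerGroup_of_eigenvalues
    (hv' : ∀ (σ : K →+* ℂ) (a : 𝓞 K), complexBetti.map (ι a).hom.hom.hom 1 (v σ) = σ (a : K) • v σ)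
    (hros : ∀ (a ac : 𝓞 K), (ac : K) = IsCMField.complexConj K (a : K) → ∀ x y : complexBetti A.X 1,
      polarizationPairingOne A.X h (A.dim - 1) (complexBetti.map (ι a).hom.hom.hom 1 x) y =
        polarizationPairingOne A.X h (A.dim - 1) x (complexBetti.map (ι ac).hom.hom.hom 1 y))
    {u : complexBetti A.X 1 ≃ₗ[ℂ] complexBetti A.X 1} (hu : u ∈ centralizerGroup A)
    {d : (K →+* ℂ) → ℂ} (hd : ∀ σ, u (v σ) = d σ • v σ) (h1 : ∀ σ, d σ * d (conjugate σ) = 1) :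
    u ∈ unitaryCentralizerGroup A h :=
  ⟨hu, fun x y ↦ by rw [polarizationPairingOne_map_map_of_eigenvalues hv' hros hd h1, one_smul]⟩

/-- **`L₀(ℂ)`: a diagonal `u ∈ C(A)^×` with `d_σ d_σ̄ = c ≠ 0` for all `σ` lies in `G(A)(ℂ)` with
multiplier `c`.** [cite: Milne1999, §1 p. 53 (L₀(A)) and §2 Prop. 2.5 (proof)] -/
theorem mem_similitudeCentralizerGroup_of_eigenvalues
    (hv' : ∀ (σ : K →+* ℂ) (a : 𝓞 K), complexBetti.map (ι a).hom.hom.hom 1 (v σ) = σ (a : K) • v σ)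
    (hros : ∀ (a ac : 𝓞 K), (ac : K) = IsCMField.complexConj K (a : K) → ∀ x y : complexBetti A.X 1,
      polarizationPairingOne A.X h (A.dim - 1) (complexBetti.map (ι a).hom.hom.hom 1 x) y =
        polarizationPairingOne A.X h (A.dim - 1) x (complexBetti.map (ι ac).hom.hom.hom 1 y))
    {u : complexBetti A.X 1 ≃ₗ[ℂ] complexBetti A.X 1} (hu : u ∈ centralizerGroup A)
    {d : (K →+* ℂ) → ℂ} (hd : ∀ σ, u (v σ) = d σ • v σ) (c : ℂˣ) (hc : ∀ σ, d σ * d (conjugate σ) = c) :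
    u ∈ similitudeCentralizerGroup A h :=
  ⟨hu, c, polarizationPairingOne_map_map_of_eigenvalues hv' hros hd hc⟩

/-- **Conversely, an element of `S(A)(ℂ)` has `d_σ d_σ̄ = 1`** (compare `Q_h(u v_σ, u v_σ̄) = d_σ d_σ̄ Q_h(v_σ, v_σ̄)`
with `Q_h(v_σ, v_σ̄) ≠ 0`). [cite: Milne1999LefschetzClasses, §1 p. 645 (S₀(A))] [cite: Milne1999, §2 Prop. 2.5 (proof)] -/
theorem eigenvalue_mul_conjugate_eq_one_of_mem_unitaryCentralizerGroup
    (hv' : ∀ (σ : K →+* ℂ) (a : 𝓞 K), complexBetti.map (ι a).hom.hom.hom 1 (v σ) = σ (a : K) • v σ)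
    (hros : ∀ (a ac : 𝓞 K), (ac : K) = IsCMField.complexConj K (a : K) → ∀ x y : complexBetti A.X 1,
      polarizationPairingOne A.X h (A.dim - 1) (complexBetti.map (ι a).hom.hom.hom 1 x) y =
        polarizationPairingOne A.X h (A.dim - 1) x (complexBetti.map (ι ac).hom.hom.hom 1 y))
    (hnd : ∀ x : complexBetti A.X 1, (∀ y, polarizationPairingOne A.X h (A.dim - 1) x y = 0) → x = 0)
    {u : complexBetti A.X 1 ≃ₗ[ℂ] complexBetti A.X 1} (hu : u ∈ unitaryCentralizerGroup A h)
    {d : (K →+* ℂ) → ℂ} (hd : ∀ σ, u (v σ) = d σ • v σ) (σ : K →+* ℂ) : d σ * d (conjugate σ) = 1 := by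
  have hq := polarizationPairingOne_basis_conjugate_ne_zero hv' hros hnd σ
  have e := hu.2 (v σ) (v (conjugate σ))
  simp only [hd, map_smul, LinearMap.smul_apply, smul_smul] at e
  have e' : (d σ * d (conjugate σ) - 1) •
      polarizationPairingOne A.X h (A.dim - 1) (v σ) (v (conjugate σ)) = 0 := by
    rw [sub_smul, one_smul, mul_comm (d σ) (d (conjugate σ)), e, sub_self]
  rcases smul_eq_zero.1 e' with h0 | h0
  · exact sub_eq_zero.1 h0
  · exact absurd h0 hq

/-- **Conversely, an element of `G(A)(ℂ)` with multiplier `c` has `d_σ d_σ̄ = c` for all `σ`.**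
[cite: Milne1999, §1 p. 53 (L₀(A)) and §2 Prop. 2.5 (proof)] -/
theorem eigenvalue_mul_conjugate_eq_of_multiplier
    (hv' : ∀ (σ : K →+* ℂ) (a : 𝓞 K), complexBetti.map (ι a).hom.hom.hom 1 (v σ) = σ (a : K) • v σ)
    (hros : ∀ (a ac : 𝓞 K), (ac : K) = IsCMField.complexConj K (a : K) → ∀ x y : complexBetti A.X 1,
      polarizationPairingOne A.X h (A.dim - 1) (complexBetti.map (ι a).hom.hom.hom 1 x) y =
        polarizationPairingOne A.X h (A.dim - 1) x (complexBetti.map (ι ac).hom.hom.hom 1 y))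
    (hnd : ∀ x : complexBetti A.X 1, (∀ y, polarizationPairingOne A.X h (A.dim - 1) x y = 0) → x = 0)
    {u : complexBetti A.X 1 ≃ₗ[ℂ] complexBetti A.X 1} {c : ℂ}
    (hc : ∀ x y : complexBetti A.X 1, polarizationPairingOne A.X h (A.dim - 1) (u x) (u y) =
      c • polarizationPairingOne A.X h (A.dim - 1) x y)
    {d : (K →+* ℂ) → ℂ} (hd : ∀ σ, u (v σ) = d σ • v σ) (σ : K →+* ℂ) : d σ * d (conjugate σ) = c := by
  have hq := polarizationPairingOne_basis_conjugate_ne_zero hv' hros hnd σ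
  have e := hc (v σ) (v (conjugate σ))
  simp only [hd, map_smul, LinearMap.smul_apply, smul_smul] at e
  have e' : (d σ * d (conjugate σ) - c) •
      polarizationPairingOne A.X h (A.dim - 1) (v σ) (v (conjugate σ)) = 0 := by
    rw [sub_smul, mul_comm (d σ) (d (conjugate σ)), e, sub_self]
  rcases smul_eq_zero.1 e' with h0 | h0
  · exact sub_eq_zero.1 h0
  · exact absurd h0 hq

end Torus

/-! ### Prop. 2.5 on `ℚ`-points: `θ(α) ∈ S(A) ⟺ α · ια = 1`, `θ(α) ∈ G(A) ⟺ α · ια ∈ ℚ^×`, `l(α) = α · ια` -/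

section RationalPoints

variable [IsCMField K] {h : complexBetti A.X 2}

/-- `σ(α) · σ̄(α) = σ(α · ια)` (`σ̄ = conj ∘ σ = σ ∘ ι` on a CM field). [folklore] -/
private theorem embedding_mul_conjugate (σ : K →+* ℂ) (α : K) :
    σ α * conjugate σ α = σ (α * IsCMField.complexConj K α) := by
  rw [map_mul, NumberField.ComplexEmbedding.conjugate_coe_eq, IsCMField.complexEmbedding_complexConj]

omit [IsCMField K] in
/-- An element of a number field on which all complex embeddings take the same value is rational
(`Tr(β) = Σ_σ σ(β) = n · c`, so `σ(β) = σ(Tr(β)/n)`). [folklore] -/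
private theorem exists_eq_algebraMap_of_forall_embedding_eq {β : K} {c : ℂ} (hβ : ∀ σ : K →+* ℂ, σ β = c) :
    ∃ q : ℚ, β = algebraMap ℚ K q := by
  classical
  have hn0 : ((Module.finrank ℚ K : ℕ) : ℂ) ≠ 0 := Nat.cast_ne_zero.2 Module.finrank_pos.ne'
  have htr : ((Algebra.trace ℚ K β : ℚ) : ℂ) = (Module.finrank ℚ K : ℕ) * c := by
    rw [← eq_ratCast (algebraMap ℚ ℂ), trace_eq_sum_embeddings ℂ (K := ℚ) (L := K),
      Finset.sum_congr (f := fun σ : K →ₐ[ℚ] ℂ ↦ σ β) (g := fun _ ↦ c) rfl fun σ _ ↦ hβ σ.toRingHom,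
      Finset.sum_const, Finset.card_univ,
      AlgHom.card ℚ K ℂ, nsmul_eq_mul]
  refine ⟨Algebra.trace ℚ K β / (Module.finrank ℚ K : ℕ), ?_⟩
  obtain ⟨σ⟩ : Nonempty (K →+* ℂ) := inferInstance
  apply σ.injective
  rw [hβ σ, eq_ratCast, map_ratCast, Rat.cast_div, Rat.cast_natCast, htr, mul_div_cancel_left₀ _ hn0]

/-- **Milne 1999b Prop. 2.5, the kernel of `l` on `ℚ`-points: `θ(α) ∈ S(A)(ℂ) ⟺ α · ια = 1`.** For a
realisation `(A, ι, θ)` of a CM type `(K; Φ)` with `θ(K) ⊆ C(A)` (`E = K` central in `End⁰(A)`, e.g.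
`A` simple), a Rosati-compatible polarization class `h` with non-degenerate `Q_h`, and `α ∈ K` acting on
`H¹` by the automorphism `u = θ(α)`: `u` preserves `Q_h` iff `α ᾱ = 1` (`d_σ = σ(α)`,
`σ(α) σ̄(α) = σ(α ᾱ)`). ("`S₀(A)(R) = {γ ∈ C₀(A) ⊗ R | γ†γ = 1}`", `†` = complex conjugation.)
[cite: Milne1999, §2 Prop. 2.5 (proof: `L(A_Ψ)(ℚ) = {α ∈ E_ψ^× | α · ια ∈ ℚ^×}`, `l(α) = α · ια`)]
[cite: Milne1999LefschetzClasses, §1 p. 645 (S₀(A))] -/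
theorem _root_.Literature.AlgebraicGeometry.ComplexMultiplication.IsCMTypeRealisation.mem_unitaryCentralizerGroup_iff_mul_conj_eq_one
    (hA : IsCMTypeRealisation Φ A ι θ)
    (hros : ∀ (a ac : 𝓞 K), (ac : K) = IsCMField.complexConj K (a : K) → ∀ x y : complexBetti A.X 1,
      polarizationPairingOne A.X h (A.dim - 1) (complexBetti.map (ι a).hom.hom.hom 1 x) y =
        polarizationPairingOne A.X h (A.dim - 1) x (complexBetti.map (ι ac).hom.hom.hom 1 y))
    (hnd : ∀ x : complexBetti A.X 1, (∀ y, polarizationPairingOne A.X h (A.dim - 1) x y = 0) → x = 0)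
    (hθ : ∀ a : K, θ a ∈ centralizerAlgebra A) {α : K} {u : complexBetti A.X 1 ≃ₗ[ℂ] complexBetti A.X 1}
    (hu : ∀ x, u x = θ α x) :
    u ∈ unitaryCentralizerGroup A h ↔ α * IsCMField.complexConj K α = 1 := by
  obtain ⟨v, hv, hv'⟩ := Deligne1982.exists_eigenbasis_of_isCMTypeRealisation hA
  have huC : u ∈ centralizerGroup A := by
    rw [mem_centralizerGroup_iff_coe_mem,
      show (u : Module.End ℂ (complexBetti A.X 1)) = θ α from LinearMap.ext hu]
    exact hθ α
  have hd : ∀ σ, u (v σ) = σ α • v σ := fun σ ↦ by rw [hu, hv]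
  refine ⟨fun hS ↦ ?_, fun h1 ↦ mem_unitaryCentralizerGroup_of_eigenvalues hv' hros huC hd fun σ ↦ by
    rw [embedding_mul_conjugate, h1, map_one]⟩
  obtain ⟨σ⟩ : Nonempty (K →+* ℂ) := inferInstance
  have e := eigenvalue_mul_conjugate_eq_one_of_mem_unitaryCentralizerGroup hv' hros hnd hS hd σ
  rw [embedding_mul_conjugate] at e
  exact σ.injective (e.trans (map_one σ).symm)

/-- **Milne 1999b Prop. 2.5 on `ℚ`-points: `θ(α) ∈ G(A)(ℂ) ⟺ α · ια ∈ ℚ^×`** — "`L(A_Ψ)` is the subtorus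
of `(𝔾_m)_{E_ψ/ℚ}` such that `L(A_Ψ)(ℚ) = {α ∈ E_ψ^× | α · ια ∈ ℚ^×}`" (through Thm. 4.4 `L ≅ G`).
Hypotheses as in `mem_unitaryCentralizerGroup_iff_mul_conj_eq_one`; the rationality of `α ᾱ` comes from
"all complex embeddings of `α ᾱ` coincide" (trace argument). [cite: Milne1999, §2 Prop. 2.5 (proof)] -/
theorem _root_.Literature.AlgebraicGeometry.ComplexMultiplication.IsCMTypeRealisation.mem_similitudeCentralizerGroup_iff_exists_rat
    (hA : IsCMTypeRealisation Φ A ι θ)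
    (hros : ∀ (a ac : 𝓞 K), (ac : K) = IsCMField.complexConj K (a : K) → ∀ x y : complexBetti A.X 1,
      polarizationPairingOne A.X h (A.dim - 1) (complexBetti.map (ι a).hom.hom.hom 1 x) y =
        polarizationPairingOne A.X h (A.dim - 1) x (complexBetti.map (ι ac).hom.hom.hom 1 y))
    (hnd : ∀ x : complexBetti A.X 1, (∀ y, polarizationPairingOne A.X h (A.dim - 1) x y = 0) → x = 0)
    (hθ : ∀ a : K, θ a ∈ centralizerAlgebra A) {α : K} {u : complexBetti A.X 1 ≃ₗ[ℂ] complexBetti A.X 1}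
    (hu : ∀ x, u x = θ α x) :
    u ∈ similitudeCentralizerGroup A h ↔
      ∃ q : ℚ, q ≠ 0 ∧ α * IsCMField.complexConj K α = algebraMap ℚ K q := by
  obtain ⟨v, hv, hv'⟩ := Deligne1982.exists_eigenbasis_of_isCMTypeRealisation hA
  have huC : u ∈ centralizerGroup A := by
    rw [mem_centralizerGroup_iff_coe_mem,
      show (u : Module.End ℂ (complexBetti A.X 1)) = θ α from LinearMap.ext hu]
    exact hθ α
  have hd : ∀ σ, u (v σ) = σ α • v σ := fun σ ↦ by rw [hu, hv]
  constructor
  · rintro ⟨-, c, hc⟩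
    have hdc : ∀ σ : K →+* ℂ, σ (α * IsCMField.complexConj K α) = c := fun σ ↦ by
      rw [← embedding_mul_conjugate]
      exact eigenvalue_mul_conjugate_eq_of_multiplier hv' hros hnd hc hd σ
    obtain ⟨q, hq⟩ := exists_eq_algebraMap_of_forall_embedding_eq hdc
    refine ⟨q, ?_, hq⟩
    rintro rfl
    obtain ⟨σ⟩ : Nonempty (K →+* ℂ) := inferInstance
    have e := hdc σ
    rw [hq, map_zero, map_zero] at e
    exact c.ne_zero e.symm
  · rintro ⟨q, hq0, hq⟩
    refine mem_similitudeCentralizerGroup_of_eigenvalues hv' hros huC hd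
      (Units.mk0 (q : ℂ) (by exact_mod_cast hq0)) fun σ ↦ ?_
    rw [embedding_mul_conjugate, hq, eq_ratCast, map_ratCast, Units.val_mk0]

/-- **The canonical character on `ℚ`-points: `l(α) = α · ια`** — if `α ᾱ = q ∈ ℚ` then `θ(α)` multiplies
the polarization pairing by `q`: `Q_h(θ(α)x, θ(α)y) = q · Q_h(x, y)` ("its canonical character `l(A_Ψ)`
sends `α` to `α · ια`"). Only Rosati-compatibility of `h` is needed. [cite: Milne1999, §2 Prop. 2.5 (proof)] -/
theorem _root_.Literature.AlgebraicGeometry.ComplexMultiplication.IsCMTypeRealisation.polarizationPairingOne_theta_theta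
    (hA : IsCMTypeRealisation Φ A ι θ)
    (hros : ∀ (a ac : 𝓞 K), (ac : K) = IsCMField.complexConj K (a : K) → ∀ x y : complexBetti A.X 1,
      polarizationPairingOne A.X h (A.dim - 1) (complexBetti.map (ι a).hom.hom.hom 1 x) y =
        polarizationPairingOne A.X h (A.dim - 1) x (complexBetti.map (ι ac).hom.hom.hom 1 y))
    {α : K} {q : ℚ} (hq : α * IsCMField.complexConj K α = algebraMap ℚ K q)
    {u : complexBetti A.X 1 ≃ₗ[ℂ] complexBetti A.X 1} (hu : ∀ x, u x = θ α x) (x y : complexBetti A.X 1) :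
    polarizationPairingOne A.X h (A.dim - 1) (u x) (u y) =
      (q : ℂ) • polarizationPairingOne A.X h (A.dim - 1) x y := by
  obtain ⟨v, hv, hv'⟩ := Deligne1982.exists_eigenbasis_of_isCMTypeRealisation hA
  have hd : ∀ σ, u (v σ) = σ α • v σ := fun σ ↦ by rw [hu, hv]
  exact polarizationPairingOne_map_map_of_eigenvalues hv' hros hd
    (fun σ ↦ by rw [embedding_mul_conjugate, hq, eq_ratCast, map_ratCast]) x y

end RationalPoints

end Literature.AlgebraicGeometry.Milne1999

end
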